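import Summits.NavierStokesRegularity.NavierStokesRegularity.Theorems.CoriolisHeadTypeIRateHessianWeight
import Summits.NavierStokesRegularity.NavierStokesRegularity.Theorems.CoriolisHeadFarFieldLimitTools
import HarnessLib

/-!
# CoriolisHeadTypeIRateHessianRate — crux `NoCoRotatingCore` (stmt-NavierStokesRegularity-22676), line
# `far_field_constancy` v2 (15c9a82ad206abb9), stub K1c: **the pressure Hessian decays like `‖y‖⁻²`** (3/4)

Generic potential theory on `ℝ³`: for `P ∈ C^∞` with `|ΔP(w)| ≤ K₂(1+‖w‖)^{−2}`, `‖∇ΔP(w)‖ ≤ K₃(1+‖w‖)^{−3}` and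
`∇P → g` at infinity,
* §3 `abs_fderiv_fderiv_apply_le`: `|∂ₑ∂_{e'}P(y)| ≤ (128 C_Γ K₃ + 15360 M₂ K₂)|B₁|‖e‖‖e'‖/‖y‖²` for `‖y‖ ≥ 1`, by
  the two-sided dyadic telescoping of the centred shell means of `∂ₑ∂_{e'}P` (down: approximate identity, small-scale
  steps from `CoriolisHeadTypeIRateHessianKernel` with ONE integration by parts; up: `abs_shellMean_fderiv2_le_of_far`
  of `CoriolisHeadTypeIRateHessianWeight`, large-scale steps with TWO integrations by parts);
* §4 `norm_fderiv_gradient_le`: the operator-norm form `‖D(∇P)(y)‖ ≤ C_H/‖y‖²` (`⟪D(∇P)(y)e, e'⟫ = ∂ₑ∂_{e'}P(y)`).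
This is the elliptic input of `CoriolisHeadTypeIRateOfLaplacianGradientDecay`; file 4/4
(`CoriolisHeadTypeIRateOfThirdOrderDecay`) derives its hypotheses from K1a and a rotated profile.  Everything is
proved; no definitions.  WHAT THIS IS NOT: K1c, K1a, `NoCoRotatingCore` stay OPEN; nothing here proves NS regularity.
References: Gilbarg–Trudinger (2001) §4.2 [GilbargTrudinger2001]; Pineau–Vicol arXiv:2607.09619 [PineauVicol2026].
-/

noncomputable section

open MeasureTheory Set Function Filter Topology Metric InnerProductSpace Real
open scoped RealInnerProductSpace Laplacian ContDiff

-- the summit and its single sub-problem share the name (CONVENTIONS §1), as in every Theorems file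
set_option linter.dupNamespace false
-- nested operator types
set_option maxSynthPendingDepth 3

namespace Summit.NavierStokesRegularity.NavierStokesRegularity.Theorems.CoriolisHead

namespace TypeIRate

open Literature.Analysis.FluidPDE

/-! ## §3 Two-sided dyadic telescoping for `∂ₑ∂_{e'}P` -/

set_option maxHeartbeats 400000 in
/-- **Pointwise `O(r⁻²)` bound for the pressure Hessian.**  Let `P ∈ C^∞(ℝ³)` with `|ΔP(w)| ≤ K₂(1+‖w‖)^{−2}`,
`‖∇ΔP(w)‖ ≤ K₃(1+‖w‖)^{−3}` and `∇P → g` at infinity.  Then for `‖y‖ ≥ 1` and all `e, e'`: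
`|∂ₑ∂_{e'}P(y)| ≤ (128 C_Γ K₃ + 15360 M₂ K₂) |B₁| ‖e‖‖e'‖ / ‖y‖²`.  Proof: telescope the centred shell means
`S_c = ∫ λ^{c,2c}(z)∂ₑ∂_{e'}P(y+z)dz` over `c = 2^j‖y‖/8`: downwards `S_c → ∂ₑ∂_{e'}P(y)` (approximate identity) with
steps `≤ A₁c` (one IBP, `∇ΔP`), upwards `S_c → 0` (`abs_shellMean_fderiv2_le_of_far`) with steps `≤ A₂/c²`
(two IBPs, `ΔP`). [cite: GilbargTrudinger2001, §4.2 (flavour)] -/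
theorem abs_fderiv_fderiv_apply_le {C M₂ M : ℝ} (hC0 : 0 ≤ C)
    (hC : ∀ w : EuclideanSpace ℝ (Fin 3), ‖w‖ ^ 2 * ‖fderiv ℝ (newtonFar 1 2) w‖ ≤ C)
    (hM₂ : ∀ w : EuclideanSpace ℝ (Fin 3), ‖fderiv ℝ (fderiv ℝ (newtonFar 1 2)) w‖ ≤ M₂)
    (hM : ∀ w : EuclideanSpace ℝ (Fin 3), ‖fderiv ℝ (newtonFarLaplacian 1 2) w‖ ≤ M)
    {P : EuclideanSpace ℝ (Fin 3) → ℝ} (hP : ContDiff ℝ ∞ P) {K₂ K₃ : ℝ} (hK₂ : 0 ≤ K₂) (hK₃ : 0 ≤ K₃)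
    (hΔ : ∀ w : EuclideanSpace ℝ (Fin 3), |(Δ P) w| ≤ K₂ / (1 + ‖w‖) ^ (2 : ℝ))
    (hΔ' : ∀ w : EuclideanSpace ℝ (Fin 3), ‖fderiv ℝ (Δ P) w‖ ≤ K₃ / (1 + ‖w‖) ^ (3 : ℝ))
    {g : EuclideanSpace ℝ (Fin 3)}
    (hg : ∀ ε : ℝ, 0 < ε → ∃ R : ℝ, ∀ w : EuclideanSpace ℝ (Fin 3), R ≤ ‖w‖ → ‖gradient P w - g‖ ≤ ε)
    (y : EuclideanSpace ℝ (Fin 3)) (hy : 1 ≤ ‖y‖) (e e' : EuclideanSpace ℝ (Fin 3)) :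
    |fderiv ℝ (fun w => fderiv ℝ P w e') y e| ≤
      (128 * C * K₃ + 15360 * M₂ * K₂) * (volume (ball (0 : EuclideanSpace ℝ (Fin 3)) 1)).toReal *
        ‖e‖ * ‖e'‖ / ‖y‖ ^ 2 := by
  obtain ⟨V₁, hV₁⟩ : ∃ V : ℝ, V = (volume (ball (0 : EuclideanSpace ℝ (Fin 3)) 1)).toReal := ⟨_, rfl⟩
  have hV₁0 : 0 ≤ V₁ := by rw [hV₁]; exact ENNReal.toReal_nonneg
  rw [← hV₁]
  have hM₂0 : 0 ≤ M₂ := (norm_nonneg _).trans (hM₂ 0)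
  have hM0 : 0 ≤ M := (norm_nonneg _).trans (hM 0)
  have hypos : 0 < ‖y‖ := one_pos.trans_le hy
  -- the centred shell means
  obtain ⟨S, hS⟩ : ∃ S : ℝ → ℝ, ∀ c, S c =
      ∫ z, newtonFarLaplacian c (2 * c) z * fderiv ℝ (fun w => fderiv ℝ P w e') (y + z) e := ⟨_, fun _ => rfl⟩
  set c₀ : ℝ := ‖y‖ / 8 with hc₀
  have hc₀pos : 0 < c₀ := by positivity
  have hc₀y : 8 * c₀ = ‖y‖ := by rw [hc₀]; ring
  set A₁ : ℝ := 1024 * C * K₃ * V₁ * ‖e‖ * ‖e'‖ / (1 + ‖y‖) ^ (3 : ℝ) with hA₁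
  set A₂ : ℝ := 120 * M₂ * K₂ * V₁ * ‖e‖ * ‖e'‖ with hA₂
  have h1y : 0 < (1 + ‖y‖) ^ (3 : ℝ) := Real.rpow_pos_of_pos (by positivity) _
  have hA₁0 : 0 ≤ A₁ := by positivity
  have hA₂0 : 0 ≤ A₂ := by positivity
  have hsmall : ∀ c : ℝ, 0 < c → 8 * c ≤ ‖y‖ → |S c - S (2 * c)| ≤ A₁ * c := by
    intro c hc hcy
    have h := abs_hessStep_le_small hC0 hC hP hΔ' y e e' hc hcy
    rw [← hV₁] at h
    rw [hS, hS, show 2 * (2 * c) = 4 * c by ring]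
    refine h.trans (le_of_eq ?_)
    rw [hA₁]
    field_simp
  have hlarge : ∀ c : ℝ, 0 < c → ‖y‖ ≤ 8 * c → 1 ≤ 8 * c → |S c - S (2 * c)| ≤ A₂ / c ^ 2 := by
    intro c hc hyc h1c
    have h := abs_hessStep_le_large hM₂ hP hK₂ hΔ y e e' hc hyc h1c
    rw [← hV₁] at h
    rw [hS, hS, show 2 * (2 * c) = 4 * c by ring]
    refine h.trans (le_of_eq ?_)
    rw [hA₂]
  -- downward telescoping
  have hdown : ∀ N : ℕ, |S (c₀ / 2 ^ N) - S c₀| ≤ A₁ * (c₀ - c₀ / 2 ^ N) := by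
    intro N
    induction N with
    | zero => simp
    | succ N ih =>
      have hc : 0 < c₀ / 2 ^ (N + 1) := by positivity
      have h2c : 2 * (c₀ / 2 ^ (N + 1)) = c₀ / 2 ^ N := by
        rw [pow_succ]; field_simp
      have h8c : 8 * (c₀ / 2 ^ (N + 1)) ≤ ‖y‖ := by
        rw [← hc₀y]
        have h1 : (1 : ℝ) ≤ 2 ^ (N + 1) := one_le_pow₀ one_le_two
        have : c₀ / 2 ^ (N + 1) ≤ c₀ := div_le_self hc₀pos.le h1
        linarith
      have hstep := hsmall _ hc h8c
      rw [h2c] at hstep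
      have htri : |S (c₀ / 2 ^ (N + 1)) - S c₀| ≤
          |S (c₀ / 2 ^ (N + 1)) - S (c₀ / 2 ^ N)| + |S (c₀ / 2 ^ N) - S c₀| := abs_sub_le _ _ _
      have hgeom : c₀ / 2 ^ N - c₀ / 2 ^ (N + 1) = c₀ / 2 ^ (N + 1) := by
        rw [pow_succ]; field_simp; ring
      nlinarith [hgeom]
  -- upward telescoping
  have hup : ∀ N : ℕ, |S c₀ - S (c₀ * 2 ^ N)| ≤ 2 * (A₂ / c₀ ^ 2) * (1 - 1 / 2 ^ N) := by
    intro N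
    induction N with
    | zero => simp
    | succ N ih =>
      have h2N : (1 : ℝ) ≤ 2 ^ N := one_le_pow₀ one_le_two
      have hc : 0 < c₀ * 2 ^ N := by positivity
      have hyc : ‖y‖ ≤ 8 * (c₀ * 2 ^ N) := by rw [← hc₀y]; nlinarith
      have h1c : 1 ≤ 8 * (c₀ * 2 ^ N) := by rw [← hc₀y] at hy; nlinarith
      have hstep := hlarge _ hc hyc h1c
      rw [show 2 * (c₀ * 2 ^ N) = c₀ * 2 ^ (N + 1) by rw [pow_succ]; ring] at hstep
      -- `A₂/(c₀ 2^N)² ≤ (A₂/c₀²)/2^N`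
      have hpow : A₂ / (c₀ * 2 ^ N) ^ 2 ≤ A₂ / c₀ ^ 2 / 2 ^ N := by
        rw [mul_pow, ← div_div]
        refine div_le_div_of_nonneg_left (by positivity) (by positivity) ?_
        calc (2 : ℝ) ^ N = 2 ^ N * 1 := (mul_one _).symm
          _ ≤ 2 ^ N * 2 ^ N := mul_le_mul_of_nonneg_left h2N (by positivity)
          _ = (2 ^ N) ^ 2 := (sq _).symm
      have htri : |S c₀ - S (c₀ * 2 ^ (N + 1))| ≤
          |S c₀ - S (c₀ * 2 ^ N)| + |S (c₀ * 2 ^ N) - S (c₀ * 2 ^ (N + 1))| := abs_sub_le _ _ _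
      have hgeom : (1 : ℝ) / 2 ^ N - 1 / 2 ^ (N + 1) = 1 / 2 ^ (N + 1) := by
        rw [pow_succ]; field_simp; ring
      have hA₂c : 0 ≤ A₂ / c₀ ^ 2 := by positivity
      have hstep' : |S (c₀ * 2 ^ N) - S (c₀ * 2 ^ (N + 1))| ≤ 2 * (A₂ / c₀ ^ 2) * (1 / 2 ^ (N + 1)) := by
        refine (hstep.trans hpow).trans (le_of_eq ?_)
        rw [pow_succ]; field_simp; ring
      nlinarith [hgeom]
  -- the downward limit
  have hφc : Continuous fun z : EuclideanSpace ℝ (Fin 3) => fderiv ℝ (fun w => fderiv ℝ P w e') (y + z) e := by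
    have hPe' : ContDiff ℝ ∞ (fun w => fderiv ℝ P w e') := (hP.fderiv_right (m := ∞) le_rfl).clm_apply contDiff_const
    exact ((hPe'.continuous_fderiv (by simp)).comp (continuous_const.add continuous_id)).clm_apply continuous_const
  have hlim_down : Tendsto (fun N : ℕ => S (c₀ / 2 ^ N)) atTop
      (𝓝 (fderiv ℝ (fun w => fderiv ℝ P w e') y e)) := by
    have hT := tendsto_integral_newtonFarLaplacian_smul one_pos one_lt_two hφc
    simp only [add_zero] at hT
    have hseq : Tendsto (fun N : ℕ => c₀ / 2 ^ N) atTop (𝓝[>] (0 : ℝ)) := by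
      refine tendsto_nhdsWithin_iff.2 ⟨?_, Eventually.of_forall fun N => ?_⟩
      · have h := (tendsto_pow_atTop_nhds_zero_of_lt_one (by norm_num : (0 : ℝ) ≤ 1 / 2)
          (by norm_num : (1 : ℝ) / 2 < 1)).const_mul c₀
        rw [mul_zero] at h
        refine h.congr fun N => ?_
        rw [one_div, inv_pow, div_eq_mul_inv]
      · exact mem_Ioi.2 (by positivity)
    have h := hT.comp hseq
    refine h.congr fun N => ?_
    simp only [Function.comp, smul_eq_mul, mul_one, hS]
    congr 1
    funext z
    rw [mul_comm (c₀ / 2 ^ N) 2]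
  -- the upward smallness
  have hlim_up : ∀ ε : ℝ, 0 < ε → ∃ N₀ : ℕ, ∀ N, N₀ ≤ N → |S (c₀ * 2 ^ N)| ≤ 8 * M * V₁ * ‖e‖ * ‖e'‖ * ε := by
    intro ε hε
    obtain ⟨Rg, hRg⟩ := hg ε hε
    obtain ⟨N₀, hN₀⟩ := pow_unbounded_of_one_lt (max (Rg + ‖y‖) 1 / c₀) (one_lt_two : (1 : ℝ) < 2)
    refine ⟨N₀, fun N hN => ?_⟩
    have hcN : max (Rg + ‖y‖) 1 / c₀ < 2 ^ N := hN₀.trans_le (pow_le_pow_right₀ one_le_two hN)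
    rw [div_lt_iff₀ hc₀pos] at hcN
    have hc1 : 1 ≤ c₀ * 2 ^ N := by
      have := le_max_right (Rg + ‖y‖) 1; linarith
    have hcR : Rg + ‖y‖ ≤ c₀ * 2 ^ N := by
      have := le_max_left (Rg + ‖y‖) 1; linarith
    have h := abs_shellMean_fderiv2_le_of_far hM hP hε.le hRg y e e' hc1 hcR
    rw [← hV₁] at h
    rw [hS]
    exact h
  -- assembling
  have hmain : |fderiv ℝ (fun w => fderiv ℝ P w e') y e| ≤ A₁ * c₀ + 2 * (A₂ / c₀ ^ 2) := by
    refine le_of_forall_pos_le_add fun ε hε => ?_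
    set ε' : ℝ := ε / (2 * (1 + 8 * M * V₁ * ‖e‖ * ‖e'‖)) with hε'
    have hden : 0 < 2 * (1 + 8 * M * V₁ * ‖e‖ * ‖e'‖) := by positivity
    have hε'pos : 0 < ε' := div_pos hε hden
    obtain ⟨N₁, hN₁⟩ := (Metric.tendsto_atTop.1 hlim_down) ε' hε'pos
    obtain ⟨N₂, hN₂⟩ := hlim_up ε' hε'pos
    have h1 : |fderiv ℝ (fun w => fderiv ℝ P w e') y e - S (c₀ / 2 ^ N₁)| ≤ ε' := by
      rw [abs_sub_comm]; exact le_of_lt (hN₁ N₁ le_rfl)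
    have h2' : |S (c₀ / 2 ^ N₁) - S c₀| ≤ A₁ * c₀ := by
      refine (hdown N₁).trans (mul_le_mul_of_nonneg_left ?_ hA₁0)
      have : 0 ≤ c₀ / 2 ^ N₁ := by positivity
      linarith
    have hA₂c : 0 ≤ A₂ / c₀ ^ 2 := by positivity
    have h3' : |S c₀ - S (c₀ * 2 ^ N₂)| ≤ 2 * (A₂ / c₀ ^ 2) := by
      refine (hup N₂).trans ?_
      have : 0 ≤ (1 : ℝ) / 2 ^ N₂ := by positivity
      nlinarith
    have h4 := hN₂ N₂ le_rfl
    have hεsum : ε' + 8 * M * V₁ * ‖e‖ * ‖e'‖ * ε' ≤ ε := by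
      rw [hε']
      rw [show ε / (2 * (1 + 8 * M * V₁ * ‖e‖ * ‖e'‖)) + 8 * M * V₁ * ‖e‖ * ‖e'‖ *
          (ε / (2 * (1 + 8 * M * V₁ * ‖e‖ * ‖e'‖))) = ε / 2 by field_simp]
      linarith
    have htri : |fderiv ℝ (fun w => fderiv ℝ P w e') y e| ≤
        |fderiv ℝ (fun w => fderiv ℝ P w e') y e - S (c₀ / 2 ^ N₁)| + |S (c₀ / 2 ^ N₁) - S c₀| +
          |S c₀ - S (c₀ * 2 ^ N₂)| + |S (c₀ * 2 ^ N₂)| := by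
      have t1 := abs_sub_le (fderiv ℝ (fun w => fderiv ℝ P w e') y e) (S (c₀ / 2 ^ N₁)) 0
      have t2 := abs_sub_le (S (c₀ / 2 ^ N₁)) (S c₀) 0
      have t3 := abs_sub_le (S c₀) (S (c₀ * 2 ^ N₂)) 0
      simp only [sub_zero] at t1 t2 t3
      linarith
    linarith
  -- cosmetics
  have hc1 : A₁ * c₀ ≤ 128 * C * K₃ * V₁ * ‖e‖ * ‖e'‖ / ‖y‖ ^ 2 := by
    have h3 : (1 + ‖y‖) ^ (3 : ℝ) = (1 + ‖y‖) ^ 3 := Real.rpow_ofNat (1 + ‖y‖) 3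
    rw [hA₁, hc₀, h3]
    have hK : 0 ≤ 128 * C * K₃ * V₁ * ‖e‖ * ‖e'‖ := by positivity
    rw [div_mul_eq_mul_div, div_le_div_iff₀ (by positivity) (by positivity)]
    -- `1024 K (‖y‖/8) ‖y‖² ≤ 128 K (1+‖y‖)³`
    have : ‖y‖ ^ 3 ≤ (1 + ‖y‖) ^ 3 := pow_le_pow_left₀ hypos.le (by linarith) 3
    nlinarith [hK]
  have hc2 : 2 * (A₂ / c₀ ^ 2) = 15360 * M₂ * K₂ * V₁ * ‖e‖ * ‖e'‖ / ‖y‖ ^ 2 := by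
    rw [hA₂, hc₀]; field_simp; ring
  calc |fderiv ℝ (fun w => fderiv ℝ P w e') y e| ≤ A₁ * c₀ + 2 * (A₂ / c₀ ^ 2) := hmain
    _ ≤ 128 * C * K₃ * V₁ * ‖e‖ * ‖e'‖ / ‖y‖ ^ 2 + 15360 * M₂ * K₂ * V₁ * ‖e‖ * ‖e'‖ / ‖y‖ ^ 2 := by
        rw [← hc2]; exact add_le_add hc1 le_rfl
    _ = _ := by ring

/-! ## §4 The operator-norm form: `‖D(∇P)(y)‖ ≤ C_H/‖y‖²` -/

/-- **Pressure-Hessian rate, operator-norm form**: under the hypotheses of `abs_fderiv_fderiv_apply_le`,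
`‖D(∇P)(y)‖ ≤ (128 C_Γ K₃ + 15360 M₂ K₂)|B₁| / ‖y‖²` for `‖y‖ ≥ 1` (`⟪D(∇P)(y)e, e'⟫ = ∂ₑ∂_{e'}P(y)` and the sup
over unit `e, e'`). [folklore] -/
theorem norm_fderiv_gradient_le {C M₂ M : ℝ} (hC0 : 0 ≤ C)
    (hC : ∀ w : EuclideanSpace ℝ (Fin 3), ‖w‖ ^ 2 * ‖fderiv ℝ (newtonFar 1 2) w‖ ≤ C)
    (hM₂ : ∀ w : EuclideanSpace ℝ (Fin 3), ‖fderiv ℝ (fderiv ℝ (newtonFar 1 2)) w‖ ≤ M₂)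
    (hM : ∀ w : EuclideanSpace ℝ (Fin 3), ‖fderiv ℝ (newtonFarLaplacian 1 2) w‖ ≤ M)
    {P : EuclideanSpace ℝ (Fin 3) → ℝ} (hP : ContDiff ℝ ∞ P) {K₂ K₃ : ℝ} (hK₂ : 0 ≤ K₂) (hK₃ : 0 ≤ K₃)
    (hΔ : ∀ w : EuclideanSpace ℝ (Fin 3), |(Δ P) w| ≤ K₂ / (1 + ‖w‖) ^ (2 : ℝ))
    (hΔ' : ∀ w : EuclideanSpace ℝ (Fin 3), ‖fderiv ℝ (Δ P) w‖ ≤ K₃ / (1 + ‖w‖) ^ (3 : ℝ))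
    {g : EuclideanSpace ℝ (Fin 3)}
    (hg : ∀ ε : ℝ, 0 < ε → ∃ R : ℝ, ∀ w : EuclideanSpace ℝ (Fin 3), R ≤ ‖w‖ → ‖gradient P w - g‖ ≤ ε)
    (y : EuclideanSpace ℝ (Fin 3)) (hy : 1 ≤ ‖y‖) :
    ‖fderiv ℝ (gradient P) y‖ ≤
      (128 * C * K₃ + 15360 * M₂ * K₂) * (volume (ball (0 : EuclideanSpace ℝ (Fin 3)) 1)).toReal / ‖y‖ ^ 2 := by
  have hM₂0 : 0 ≤ M₂ := (norm_nonneg _).trans (hM₂ 0)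
  have hypos : 0 < ‖y‖ := one_pos.trans_le hy
  set Cf : ℝ := (128 * C * K₃ + 15360 * M₂ * K₂) * (volume (ball (0 : EuclideanSpace ℝ (Fin 3)) 1)).toReal
    with hCf
  have hCf0 : 0 ≤ Cf := by positivity
  -- `∇P` is differentiable and `⟪D(∇P)(y)e, e'⟫ = ∂ₑ∂_{e'}P(y)`
  have hgrad : gradient P = fun w => (InnerProductSpace.toDual ℝ (EuclideanSpace ℝ (Fin 3))).symm (fderiv ℝ P w) :=
    rfl
  have hgd : Differentiable ℝ (gradient P) := by
    rw [hgrad]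
    exact (InnerProductSpace.toDual ℝ (EuclideanSpace ℝ (Fin 3))).symm.differentiable.comp
      ((hP.fderiv_right (m := 1) (by norm_cast)).differentiable one_ne_zero)
  have hcomp : ∀ e e' : EuclideanSpace ℝ (Fin 3),
      ⟪fderiv ℝ (gradient P) y e, e'⟫ = fderiv ℝ (fun w => fderiv ℝ P w e') y e := by
    intro e e'
    have hfun : (fun w => fderiv ℝ P w e') = fun w => (innerSL ℝ e') (gradient P w) := by
      funext w
      rw [innerSL_apply_apply, real_inner_comm, Literature.Analysis.FluidPDE.inner_gradient_left]
    have hd : HasFDerivAt (fun w => (innerSL ℝ e') (gradient P w)) ((innerSL ℝ e').comp (fderiv ℝ (gradient P) y)) y :=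
      (innerSL ℝ e').hasFDerivAt.comp y (hgd y).hasFDerivAt
    rw [hfun, hd.fderiv, ContinuousLinearMap.comp_apply, innerSL_apply_apply, real_inner_comm]
  refine ContinuousLinearMap.opNorm_le_bound _ (by positivity) fun e => ?_
  have hc : 0 ≤ Cf / ‖y‖ ^ 2 * ‖e‖ := by positivity
  rw [show Cf / ‖y‖ ^ 2 * ‖e‖ = Cf * ‖e‖ / ‖y‖ ^ 2 by ring] at hc ⊢
  refine FarFieldLimit.norm_le_of_forall_abs_inner_le hc fun e' => ?_
  rw [hcomp]
  refine (abs_fderiv_fderiv_apply_le hC0 hC hM₂ hM hP hK₂ hK₃ hΔ hΔ' hg y hy e e').trans (le_of_eq ?_)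
  rw [hCf]; ring

end TypeIRate

end Summit.NavierStokesRegularity.NavierStokesRegularity.Theorems.CoriolisHead

end
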